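import Mathlib.GroupTheory.SpecificGroups.Cyclic
import Mathlib.GroupTheory.Index
import Mathlib.GroupTheory.Abelianization.Defs
import Mathlib.FieldTheory.Finite.Basic
import Mathlib.Algebra.GroupWithZero.Action.Basic
import HarnessLib

/-!
# The character of a group acting on an additive group of prime order `p`: the action is through `(ℤ/pℤ)^×`, so the
# kernel has abelian quotient of order dividing `p − 1` (proved; no named fact)

Topic `GroupTheory` (namespace `Literature.GroupTheory.PrimeOrderModuleCharacter`).  THEOREM-ONLY file written by the prover
seat `bsd-eis-lam-a` g20 (cell `bsd-eis`; `--supports` stmt-BirchSwinnertonDyer-19035, crux 5 `MazurMCOnX1RankZero`, stub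
`stub_publishedL59`; closes nothing).  Greenberg, LNM 1716, proof of Lemma 5.9: «Let `θ` be the character (with values in
`(ℤ/pℤ)^×`) which gives the action of `Gal(ℚ_Σ/ℚ)` on `Θ`» — for a group `G` acting by additive automorphisms on an
additive group `Θ` of prime order `p` (so `Θ ≅ ℤ/pℤ`):

* **`exists_character`** — there is a homomorphism `χ : G →* (ZMod p)ˣ` with `σ • m = (χ σ).val • m` for all `σ, m`;
* `character_eq_one_iff` — `χ σ = 1 ↔ σ` acts trivially;
* `smul_comm_of_card_eq_prime`, `commutator_smul_eq` — the action is commutative (`σ • τ • m = τ • σ • m`), so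
  commutators act trivially;
* `index_dvd_sub_one_of_mem_iff`, `index_coprime_of_mem_iff`, `commutator_le_of_mem_iff` — a subgroup `N` with
  `σ ∈ N ↔ σ` acts trivially (the kernel of the action) contains `⁅G, G⁆` and has index dividing `p − 1`, hence prime to `p`.

These are the group-theoretic facts about Greenberg's `Θ` used to set up the field `ℚ(Θ)` (abelian over `ℚ`, of degree
prime to `p`) in the tower step of Lemma 5.9.

References: [GreenbergLNM1716] §5 Lemma 5.9 (proof, p. 143: the character `θ` of `Θ`); [SerreLocalFields1979] Ch. IV §1
(groups of prime order and their automorphisms).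
-/

set_option autoImplicit false

noncomputable section

namespace Literature.GroupTheory.PrimeOrderModuleCharacter

variable {G : Type*} [Group G] {Θ : Type*} [AddCommGroup Θ] [DistribMulAction G Θ] {p : ℕ} [hp : Fact p.Prime]

/-- On `ZMod p` every additive endomorphism is `x ↦ x * f 1`. [folklore] -/
private theorem addMonoidHom_zmod_apply (f : ZMod p →+ ZMod p) (x : ZMod p) : f x = x * f 1 := by
  have hx : x = ((x.val : ℕ) : ZMod p) := (ZMod.natCast_zmod_val x).symm
  conv_lhs => rw [hx, ← nsmul_one, map_nsmul, nsmul_eq_mul]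
  rw [← hx]

/-- **The character of an action on a group of prime order.**  If `G` acts by additive automorphisms on an additive group
`Θ` of prime order `p`, there is a homomorphism `χ : G →* (ZMod p)ˣ` such that `σ • m = (χ σ).val • m` for all `σ ∈ G`,
`m ∈ Θ` (Greenberg's `θ`: «the character (with values in `(ℤ/pℤ)^×`) which gives the action … on `Θ`»).
[cite: GreenbergLNM1716, §5 Lemma 5.9 (proof, p. 143)] -/
theorem exists_character (hΘ : Nat.card Θ = p) :
    ∃ χ : G →* (ZMod p)ˣ, ∀ (σ : G) (m : Θ), σ • m = ((χ σ : ZMod p).val) • m := by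
  classical
  have hp' : p.Prime := hp.out
  -- `Θ ≃+ ZMod p`
  let e : Θ ≃+ ZMod p := addEquivOfPrimeCardEq hΘ (Nat.card_zmod p)
  -- the scalar of `σ`
  let a : G → ZMod p := fun σ => e (σ • e.symm 1)
  have key : ∀ (σ : G) (m : Θ), e (σ • m) = e m * a σ := by
    intro σ m
    let f : ZMod p →+ ZMod p :=
      (e.toAddMonoidHom.comp (DistribSMul.toAddMonoidHom Θ σ)).comp e.symm.toAddMonoidHom
    have hf : ∀ x, f x = e (σ • e.symm x) := fun _ => rfl
    have h1 := addMonoidHom_zmod_apply f (e m)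
    rw [hf, hf, e.symm_apply_apply] at h1
    exact h1
  have hsmul : ∀ (σ : G) (m : Θ), σ • m = e.symm (e m * a σ) := fun σ m => by
    rw [← key, e.symm_apply_apply]
  -- `a σ ≠ 0`
  have ha0 : ∀ σ : G, a σ ≠ 0 := by
    intro σ h0
    have h1 : σ • e.symm 1 = 0 := by
      rw [hsmul, e.apply_symm_apply, one_mul, h0, map_zero]
    have h2 : e.symm 1 = 0 := by
      have := congrArg (fun m => σ⁻¹ • m) h1
      simpa only [inv_smul_smul, smul_zero] using this
    have h3 : (1 : ZMod p) = 0 := by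
      have := congrArg e h2
      rwa [e.apply_symm_apply, map_zero] at this
    exact one_ne_zero h3
  -- multiplicativity
  have hmul : ∀ σ τ : G, a (σ * τ) = a σ * a τ := by
    intro σ τ
    change e ((σ * τ) • e.symm 1) = _
    rw [mul_smul, key, key, e.apply_symm_apply, one_mul, mul_comm]
  have hone : a 1 = 1 := by
    change e ((1 : G) • e.symm 1) = 1
    rw [one_smul, e.apply_symm_apply]
  let χ : G →* (ZMod p)ˣ :=
    { toFun := fun σ => Units.mk0 (a σ) (ha0 σ)
      map_one' := Units.ext hone
      map_mul' := fun σ τ => Units.ext (hmul σ τ) }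
  refine ⟨χ, fun σ m => ?_⟩
  have hχ : ((χ σ : ZMod p)) = a σ := rfl
  rw [hχ, hsmul σ m]
  apply e.injective
  rw [e.apply_symm_apply, map_nsmul, nsmul_eq_mul, ZMod.natCast_zmod_val, mul_comm]

/-- For a character as in `exists_character`: `χ σ = 1` iff `σ` acts trivially. [cite: GreenbergLNM1716, §5 Lemma 5.9 (proof, p. 143)] -/
theorem character_eq_one_iff (hΘ : Nat.card Θ = p) {χ : G →* (ZMod p)ˣ}
    (hχ : ∀ (σ : G) (m : Θ), σ • m = ((χ σ : ZMod p).val) • m) (σ : G) :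
    χ σ = 1 ↔ ∀ m : Θ, σ • m = m := by
  classical
  have hp' : p.Prime := hp.out
  constructor
  · intro h m
    rw [hχ, h, Units.val_one, ZMod.val_one, one_smul]
  · intro h
    -- `Θ` has an element of order `p`, on which `χ σ` must act trivially
    haveI : Finite Θ := Nat.finite_of_card_ne_zero (by rw [hΘ]; exact hp'.ne_zero)
    obtain ⟨m, hm⟩ : ∃ m : Θ, m ≠ 0 := by
      by_contra hall
      push Not at hall
      haveI : Subsingleton Θ := ⟨fun a b => by rw [hall a, hall b]⟩
      have : Nat.card Θ ≤ 1 := Finite.card_le_one_iff_subsingleton.mpr inferInstance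
      rw [hΘ] at this
      exact absurd this (not_le.mpr hp'.one_lt)
    have horder : addOrderOf m = p := by
      have hdvd : addOrderOf m ∣ p := by rw [← hΘ]; exact addOrderOf_dvd_natCard m
      rcases (Nat.dvd_prime hp').mp hdvd with h1 | h1
      · exact absurd (AddMonoid.addOrderOf_eq_one_iff.mp h1) hm
      · exact h1
    have h1 := hχ σ m
    rw [h m] at h1
    -- `(χ σ).val • m = m` with `m` of order `p` forces `(χ σ).val ≡ 1 (mod p)`
    have h2 : ((χ σ : ZMod p).val : ZMod p) = 1 := by
      have h3 : ((χ σ : ZMod p).val - 1 : ℤ) • m = 0 := by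
        rw [sub_smul, one_smul, natCast_zsmul, ← h1, sub_self]
      have h4 : (p : ℤ) ∣ ((χ σ : ZMod p).val - 1 : ℤ) := by
        have := addOrderOf_dvd_iff_zsmul_eq_zero.mpr h3
        rwa [horder] at this
      have h5 : (((χ σ : ZMod p).val - 1 : ℤ) : ZMod p) = 0 := (ZMod.intCast_zmod_eq_zero_iff_dvd _ _).mpr h4
      push_cast at h5
      exact sub_eq_zero.mp h5
    rw [ZMod.natCast_zmod_val] at h2
    exact Units.ext h2

/-- **The action on a group of prime order is commutative.** [cite: GreenbergLNM1716, §5 Lemma 5.9 (proof, p. 143)] -/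
theorem smul_comm_of_card_eq_prime (hΘ : Nat.card Θ = p) (σ τ : G) (m : Θ) : σ • τ • m = τ • σ • m := by
  obtain ⟨χ, hχ⟩ := exists_character (G := G) hΘ
  rw [hχ τ m, smul_comm σ, hχ σ m, hχ τ, ← mul_smul]

/-- **Commutators act trivially on a group of prime order.** [cite: GreenbergLNM1716, §5 Lemma 5.9 (proof, p. 143)] -/
theorem commutator_smul_eq (hΘ : Nat.card Θ = p) (σ τ : G) (m : Θ) : (σ * τ * σ⁻¹ * τ⁻¹) • m = m := by
  rw [mul_smul, mul_smul, mul_smul, smul_comm_of_card_eq_prime hΘ σ⁻¹ τ⁻¹ m, smul_inv_smul, smul_inv_smul]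

/-- **The elements acting trivially form a subgroup of index dividing `p − 1`**: for every subgroup `N` with
`σ ∈ N ↔ σ` acts trivially, `[G : N] ∣ p − 1` (the quotient embeds in `(ℤ/pℤ)^×`); in particular `[G : N]` is prime to `p`.
[cite: GreenbergLNM1716, §5 Lemma 5.9 (proof, p. 143)] -/
theorem index_dvd_sub_one_of_mem_iff (hΘ : Nat.card Θ = p) (N : Subgroup G) (hN : ∀ σ, σ ∈ N ↔ ∀ m : Θ, σ • m = m) :
    N.index ∣ p - 1 := by
  classical
  obtain ⟨χ, hχ⟩ := exists_character (G := G) hΘ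
  have hker : χ.ker = N := by
    ext σ
    rw [MonoidHom.mem_ker, character_eq_one_iff hΘ hχ, hN]
  rw [← hker, Subgroup.index_ker, ← ZMod.card_units p, ← Nat.card_eq_fintype_card]
  exact Subgroup.card_subgroup_dvd_card χ.range

/-- The index of the subgroup of elements acting trivially is prime to `p`. [cite: GreenbergLNM1716, §5 Lemma 5.9 (proof, p. 143)] -/
theorem index_coprime_of_mem_iff (hΘ : Nat.card Θ = p) (N : Subgroup G) (hN : ∀ σ, σ ∈ N ↔ ∀ m : Θ, σ • m = m) :
    N.index.Coprime p := by
  have hp' : p.Prime := hp.out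
  have hdvd := index_dvd_sub_one_of_mem_iff hΘ N hN
  have h1 : (p - 1).Coprime p :=
    ((Nat.Prime.coprime_iff_not_dvd hp').mpr
      (Nat.not_dvd_of_pos_of_lt (Nat.sub_pos_of_lt hp'.one_lt) (Nat.sub_lt hp'.pos one_pos))).symm
  exact Nat.Coprime.of_dvd_left hdvd h1

/-- The commutator subgroup acts trivially: `⁅G, G⁆ ≤ N` for the subgroup `N` of elements acting trivially.
[cite: GreenbergLNM1716, §5 Lemma 5.9 (proof, p. 143)] -/
theorem commutator_le_of_mem_iff (hΘ : Nat.card Θ = p) (N : Subgroup G) (hN : ∀ σ, σ ∈ N ↔ ∀ m : Θ, σ • m = m) :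
    ⁅(⊤ : Subgroup G), ⊤⁆ ≤ N := by
  classical
  obtain ⟨χ, hχ⟩ := exists_character (G := G) hΘ
  have hker : χ.ker = N := by
    ext σ
    rw [MonoidHom.mem_ker, character_eq_one_iff hΘ hχ, hN]
  rw [← hker]
  intro y hy
  rw [← commutator_def] at hy
  exact Abelianization.commutator_subset_ker χ hy

end Literature.GroupTheory.PrimeOrderModuleCharacter

end
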